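import Summits.Ventures.CertifiedQuantumChemistry.Rows.GroundStateOverlapRows
import Summits.Ventures.CertifiedQuantumChemistry.Rows.SecondEigenvalueUpperRows
import HarnessLib

/-!
# Rows/GroundStateOverlapTransfer.lean: TRANSFER of a certified ground-state overlap from a correlated reference
# vector to a second vector (a single determinant) — the exact, square-root-free test the kernel checks

HONEST FRAMING (verbatim): certified bounds for a stated model Hamiltonian in a stated basis; not a claim about
the real molecule or material beyond that model.

LADDER-CHEM I-TYPE (cell chem-oracle, seat chem-type-06 gen 5, offer (J) second half, chem-lead B8-1 GO; SIBLING of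
`Rows/GroundStateOverlapRows.lean` p484644). There, `OverlapLowerRow F a b φ w` («every ground state `ψ` of `F` in
`(a, b)` has `cos² ∠(φ, ψ) ≥ w`») is certified by Eckart's criterion for a reference vector `φ` whose Rayleigh
quotient lies BELOW the certified gap leg. On the cell's first consumer file (N₂/STO-6G `02f61ad9`, `(7,7)`) the bare
reference DETERMINANT fails that test (its energy sits above `β*`), while short CI records pass it easily — so the
reference-determinant WEIGHT the cell reports as the float `w₀` is certified in two steps: Eckart for a correlated
record `φ`, then a TRANSFER from `φ` to `|D⟩` through the exact overlap of the two explicit vectors. The transfer is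
the triangle inequality for angles between unit vectors (Goodisman 1973 Ch. III §A.2, the remark after eq. (12):
Weinhold's bound on the overlap of `Φ` with the exact function «using the overlap of `Φ` and `Φ′`»):
`|⟨d, ψ⟩| ≥ |⟨d, φ⟩|·|⟨φ, ψ⟩| − √(1 − |⟨d, φ⟩|²)·√(1 − |⟨φ, ψ⟩|²)` (`norm_star_dotProduct_ge_of_unit`, proved here
from the orthogonal splitting along `φ` and Cauchy–Schwarz — elementary, in-house). For the kernel the test is made
SQUARE-ROOT-FREE and rational: with `a ≤ cos² ∠(d, φ)` (exact for two CI records: `crossNormSq² / (normSq·normSq)`)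
and `w ≤ cos² ∠(φ, ψ)` (the certified row), a slot `w′ ≥ 0` is admissible iff
`Δ := a·w − w′ − (1 − a)(1 − w) ≥ 0` and `4·w′·(1 − a)(1 − w) ≤ Δ²` (`overlapLowerRow_transfer`); CI entry
`CIVec.overlapLowerRow_transfer`, single-determinant target `CIVec.weightRow_transfer` (reads as
`w′·‖ψ‖² ≤ |ψ(D)|²` by `OverlapLowerRow.weight_le`).
Honest limits: the transfer only LOSES (it is sharp when `d`, `φ`, `ψ` are coplanar); it needs `a·w > (1 − a)(1 − w)`
to say anything; everything is a statement about the MODEL's ground state in the pinned orbital basis.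
NOT here: any number, producer or claim node; Eckart's criterion itself (sibling file); `⟨S²⟩`.
-/

noncomputable section

namespace Summit.Ventures.CertifiedQuantumChemistry

open Matrix Finset
open Literature.MathematicalPhysics.QuantumLattice Literature.MathematicalPhysics.QuantumChemistry
open Literature.MathematicalPhysics.QuantumLattice.EigenvalueContinuation
open scoped ComplexOrder

variable {k : ℕ}

/-! ## §1 The triangle inequality for angles between unit vectors -/

section Generic

variable {ι : Type*} [Fintype ι] [DecidableEq ι]

/-- Norm square of the component of a unit vector `x` orthogonal to a unit vector `φ`:
`‖x − ⟨φ,x⟩φ‖² = 1 − |⟨φ,x⟩|²` (Pythagoras along the splitting `x = ⟨φ,x⟩φ + x⊥`). [folklore] -/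
private theorem re_norm_orth_component {φ x : ι → ℂ} (hφ1 : star φ ⬝ᵥ φ = 1) (hx1 : star x ⬝ᵥ x = 1) :
    (star (x - (star φ ⬝ᵥ x) • φ) ⬝ᵥ (x - (star φ ⬝ᵥ x) • φ)).re = 1 - ‖star φ ⬝ᵥ x‖ ^ 2 := by
  obtain ⟨hz, hsplit⟩ := TempleKato.orth_split hφ1 x
  have h1 : (1 : Matrix ι ι ℂ)ᴴ = 1 := conjTranspose_one
  have hAφ : (1 : Matrix ι ι ℂ) *ᵥ φ = ((1 : ℝ) : ℂ) • φ := by rw [one_mulVec, Complex.ofReal_one, one_smul]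
  obtain ⟨hn, -⟩ := TempleKato.norm_energy_pair h1 hAφ hz (star φ ⬝ᵥ x) 1
  rw [← hsplit, hx1, hφ1, Complex.one_re, mul_one, norm_one, one_pow, one_mul] at hn
  linarith

/-- **Triangle inequality for angles (overlap transfer).** For unit vectors `d`, `φ`, `ψ`:
`|⟨φ,d⟩|·|⟨φ,ψ⟩| − √((1 − |⟨φ,d⟩|²)(1 − |⟨φ,ψ⟩|²)) ≤ |⟨d,ψ⟩|` — split `d` and `ψ` along `φ`:
`⟨d,ψ⟩ = conj⟨φ,d⟩·⟨φ,ψ⟩ + ⟨d⊥,ψ⊥⟩` with `|⟨d⊥,ψ⊥⟩| ≤ ‖d⊥‖‖ψ⊥‖` (Cauchy–Schwarz). The step behind Weinhold's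
overlap bound quoted by Goodisman (1973) Ch. III §A.2 after eq. (12); in-house elementary proof.
[cite: Goodisman1973, Ch. III §A.2 eqs. (10)–(12), pp. 92–93] -/
theorem norm_star_dotProduct_ge_of_unit {d φ ψ : ι → ℂ} (hd1 : star d ⬝ᵥ d = 1) (hφ1 : star φ ⬝ᵥ φ = 1)
    (hψ1 : star ψ ⬝ᵥ ψ = 1) :
    ‖star φ ⬝ᵥ d‖ * ‖star φ ⬝ᵥ ψ‖ -
        Real.sqrt ((1 - ‖star φ ⬝ᵥ d‖ ^ 2) * (1 - ‖star φ ⬝ᵥ ψ‖ ^ 2)) ≤ ‖star d ⬝ᵥ ψ‖ := by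
  obtain ⟨hzd, hsplitd⟩ := TempleKato.orth_split hφ1 d
  obtain ⟨hzψ, hsplitψ⟩ := TempleKato.orth_split hφ1 ψ
  set α : ℂ := star φ ⬝ᵥ d with hα
  set γ : ℂ := star φ ⬝ᵥ ψ with hγ
  set dp : ι → ℂ := d - α • φ with hdp
  set ψp : ι → ℂ := ψ - γ • φ with hψp
  -- the splitting of the pairing
  have hφψp : star φ ⬝ᵥ ψp = 0 := hzψ
  have hdpφ : star dp ⬝ᵥ φ = 0 := by
    have : star φ ⬝ᵥ dp = 0 := hzd
    rw [star_dotProduct, this, star_zero]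
  have hpair : star d ⬝ᵥ ψ = star α * γ + star dp ⬝ᵥ ψp := by
    conv_lhs => rw [hsplitd, hsplitψ]
    simp only [one_smul, star_add, star_smul, add_dotProduct, dotProduct_add, smul_dotProduct,
      dotProduct_smul, smul_eq_mul, hφ1, hφψp, hdpφ, mul_one, mul_zero, add_zero, zero_add]
    ring
  -- norms of the orthogonal components
  have hnd : (star dp ⬝ᵥ dp).re = 1 - ‖α‖ ^ 2 := re_norm_orth_component hφ1 hd1
  have hnψ : (star ψp ⬝ᵥ ψp).re = 1 - ‖γ‖ ^ 2 := re_norm_orth_component hφ1 hψ1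
  -- Cauchy–Schwarz on the orthogonal components
  have hCS : ‖star dp ⬝ᵥ ψp‖ ≤ Real.sqrt ((1 - ‖α‖ ^ 2) * (1 - ‖γ‖ ^ 2)) := by
    apply Real.le_sqrt_of_sq_le
    rw [← hnd, ← hnψ]
    exact norm_star_dotProduct_sq_le dp ψp
  -- reverse triangle inequality
  have htri : ‖star α * γ‖ - ‖star dp ⬝ᵥ ψp‖ ≤ ‖star d ⬝ᵥ ψ‖ := by
    rw [hpair]
    have := norm_sub_le_norm_add (star α * γ) (star dp ⬝ᵥ ψp)
    have h2 : ‖star α * γ‖ ≤ ‖star α * γ + star dp ⬝ᵥ ψp‖ + ‖star dp ⬝ᵥ ψp‖ := by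
      calc ‖star α * γ‖ = ‖(star α * γ + star dp ⬝ᵥ ψp) - star dp ⬝ᵥ ψp‖ := by rw [add_sub_cancel_right]
        _ ≤ ‖star α * γ + star dp ⬝ᵥ ψp‖ + ‖star dp ⬝ᵥ ψp‖ := norm_sub_le _ _
    linarith
  have hαγ : ‖star α * γ‖ = ‖α‖ * ‖γ‖ := by rw [norm_mul, norm_star]
  rw [hαγ] at htri
  linarith

end Generic

/-! ## §2 The square-root-free transfer test and the row it certifies -/

/-- **Arithmetic core of the transfer test.** For reals `0 ≤ a ≤ 1`, `0 ≤ w ≤ 1`, `0 ≤ w′`, `x, y ∈ [0, 1]` with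
`a ≤ x²`, `w ≤ y²`, and the two rational test inequalities `0 ≤ Δ`, `4w′(1 − a)(1 − w) ≤ Δ²`
(`Δ = aw − w′ − (1 − a)(1 − w)`): `√w′ ≤ x·y − √((1 − x²)(1 − y²))`. (Monotonicity of the right-hand side in
`x`, `y`, then `√(aw) ≥ √w′ + √((1−a)(1−w))` by squaring twice.) [folklore] -/
private theorem sqrt_le_of_transfer_test {a w w' x y : ℝ} (ha0 : 0 ≤ a) (hw0 : 0 ≤ w) (hw'0 : 0 ≤ w')
    (hx0 : 0 ≤ x) (hx1 : x ≤ 1) (hy0 : 0 ≤ y) (hy1 : y ≤ 1) (hax : a ≤ x ^ 2) (hwy : w ≤ y ^ 2)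
    (hD : 0 ≤ a * w - w' - (1 - a) * (1 - w))
    (hD2 : 4 * w' * ((1 - a) * (1 - w)) ≤ (a * w - w' - (1 - a) * (1 - w)) ^ 2) :
    Real.sqrt w' ≤ x * y - Real.sqrt ((1 - x ^ 2) * (1 - y ^ 2)) := by
  have ha1 : a ≤ 1 := hax.trans (by nlinarith)
  have hw1 : w ≤ 1 := hwy.trans (by nlinarith)
  set R' : ℝ := (1 - a) * (1 - w) with hR'
  set Δ : ℝ := a * w - w' - R' with hΔ
  have hR'0 : 0 ≤ R' := mul_nonneg (by linarith) (by linarith)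
  -- `√(aw) ≤ x y`
  have h1 : Real.sqrt (a * w) ≤ x * y := by
    rw [Real.sqrt_le_left (mul_nonneg hx0 hy0)]
    calc a * w ≤ x ^ 2 * y ^ 2 := mul_le_mul hax hwy hw0 (sq_nonneg x)
      _ = (x * y) ^ 2 := by ring
  -- `√((1−x²)(1−y²)) ≤ √R'`
  have h2 : Real.sqrt ((1 - x ^ 2) * (1 - y ^ 2)) ≤ Real.sqrt R' := by
    apply Real.sqrt_le_sqrt
    exact mul_le_mul (by linarith) (by linarith) (by nlinarith) (by linarith)
  -- `2√(w' R') ≤ Δ` from `4 w' R' ≤ Δ²`, `Δ ≥ 0`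
  have h3 : 2 * Real.sqrt (w' * R') ≤ Δ := by
    have h4 : Real.sqrt (4 * (w' * R')) ≤ Δ := by
      rw [Real.sqrt_le_left hD]
      calc 4 * (w' * R') = 4 * w' * R' := by ring
        _ ≤ Δ ^ 2 := hD2
    have h5 : Real.sqrt (4 * (w' * R')) = 2 * Real.sqrt (w' * R') := by
      rw [Real.sqrt_mul (by norm_num : (0:ℝ) ≤ 4), show (4:ℝ) = 2 ^ 2 by norm_num,
        Real.sqrt_sq (by norm_num : (0:ℝ) ≤ 2)]
    linarith
  -- `√w' + √R' ≤ √(a w)` by squaring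
  have h6 : Real.sqrt w' + Real.sqrt R' ≤ Real.sqrt (a * w) := by
    rw [Real.le_sqrt (add_nonneg (Real.sqrt_nonneg _) (Real.sqrt_nonneg _)) (mul_nonneg ha0 hw0)]
    have e : (Real.sqrt w' + Real.sqrt R') ^ 2 = w' + R' + 2 * (Real.sqrt w' * Real.sqrt R') := by
      rw [add_sq, Real.sq_sqrt hw'0, Real.sq_sqrt hR'0]; ring
    rw [e, ← Real.sqrt_mul hw'0]
    linarith
  linarith

variable {F : Model k} {a b : ℕ}

/-- **OVERLAP TRANSFER (row level).** If every ground state `ψ` of `F` in `(a, b)` has `cos² ∠(φ, ψ) ≥ w`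
(`OverlapLowerRow F a b φ w`, e.g. from Eckart's criterion), and a second explicit NONZERO vector `d` has
`cos² ∠(d, φ) ≥ aφ` (exact for explicit vectors: `aφ·⟨d,d⟩⟨φ,φ⟩ ≤ |⟨d,φ⟩|²`), then every ground state has
`cos² ∠(d, ψ) ≥ w′` — `OverlapLowerRow F a b d w′` — for every rational `w′ ≥ 0` passing the square-root-free test
`0 ≤ Δ ∧ 4w′(1 − aφ)(1 − w) ≤ Δ²`, `Δ = aφ·w − w′ − (1 − aφ)(1 − w)` (`0 ≤ aφ`, `0 ≤ w` needed; `aφ, w ≤ 1` follow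
from Cauchy–Schwarz). Triangle inequality for angles (`norm_star_dotProduct_ge_of_unit`) at the normalised
vectors. [cite: Goodisman1973, Ch. III §A.2 eqs. (10)–(12), pp. 92–93] -/
theorem OverlapLowerRow.transfer {φ d : Fock (Orb (Fin k))} {w aφ w' : ℚ} (h : OverlapLowerRow F a b φ w)
    (hφ0 : φ ≠ 0) (hd0 : d ≠ 0)
    (ha : ((aφ : ℚ) : ℝ) * ((star d ⬝ᵥ d).re * (star φ ⬝ᵥ φ).re) ≤ ‖star d ⬝ᵥ φ‖ ^ 2)
    (ha0 : 0 ≤ aφ) (hw0 : 0 ≤ w) (hw'0 : 0 ≤ w')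
    (hD : 0 ≤ aφ * w - w' - (1 - aφ) * (1 - w))
    (hD2 : 4 * w' * ((1 - aφ) * (1 - w)) ≤ (aφ * w - w' - (1 - aφ) * (1 - w)) ^ 2) :
    OverlapLowerRow F a b d w' := by
  refine ⟨h.1, fun ψ hψ => ?_⟩
  -- normalise the three vectors
  obtain ⟨cd, hcd, hcdd, hcd1⟩ := exists_normalize hd0
  obtain ⟨cφ, hcφ, hcφφ, hcφ1⟩ := exists_normalize hφ0
  obtain ⟨cψ, hcψ, hcψψ, hcψ1⟩ := exists_normalize hψ.2.1
  set d' : Fock (Orb (Fin k)) := (cd : ℂ) • d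
  set φ' : Fock (Orb (Fin k)) := (cφ : ℂ) • φ
  set ψ' : Fock (Orb (Fin k)) := (cψ : ℂ) • ψ
  -- the three cosines
  set x : ℝ := ‖star φ' ⬝ᵥ d'‖ with hx
  set y : ℝ := ‖star φ' ⬝ᵥ ψ'‖ with hy
  set z : ℝ := ‖star d' ⬝ᵥ ψ'‖ with hz
  have hxs : x ^ 2 = (cφ * cφ) * (cd * cd) * ‖star φ ⬝ᵥ d‖ ^ 2 := by
    rw [hx, star_smul, smul_dotProduct, dotProduct_smul, smul_smul, smul_eq_mul, norm_mul, norm_mul,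
      Complex.star_def, Complex.conj_ofReal, Complex.norm_real, Complex.norm_real, Real.norm_eq_abs,
      Real.norm_eq_abs, mul_pow, mul_pow, sq_abs, sq_abs]; ring
  have hys : y ^ 2 = (cφ * cφ) * (cψ * cψ) * ‖star φ ⬝ᵥ ψ‖ ^ 2 := by
    rw [hy, star_smul, smul_dotProduct, dotProduct_smul, smul_smul, smul_eq_mul, norm_mul, norm_mul,
      Complex.star_def, Complex.conj_ofReal, Complex.norm_real, Complex.norm_real, Real.norm_eq_abs,
      Real.norm_eq_abs, mul_pow, mul_pow, sq_abs, sq_abs]; ring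
  have hzs : z ^ 2 = (cd * cd) * (cψ * cψ) * ‖star d ⬝ᵥ ψ‖ ^ 2 := by
    rw [hz, star_smul, smul_dotProduct, dotProduct_smul, smul_smul, smul_eq_mul, norm_mul, norm_mul,
      Complex.star_def, Complex.conj_ofReal, Complex.norm_real, Complex.norm_real, Real.norm_eq_abs,
      Real.norm_eq_abs, mul_pow, mul_pow, sq_abs, sq_abs]; ring
  -- `a ≤ x²`, `w ≤ y²`
  have hsym : ‖star d ⬝ᵥ φ‖ = ‖star φ ⬝ᵥ d‖ := by rw [star_dotProduct, norm_star]
  have hax : ((aφ : ℚ) : ℝ) ≤ x ^ 2 := by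
    rw [hxs]
    have e : (cφ * cφ) * (cd * cd) * ‖star φ ⬝ᵥ d‖ ^ 2 =
        (cd * cd) * (cφ * cφ) * ‖star d ⬝ᵥ φ‖ ^ 2 := by rw [hsym]; ring
    rw [e]
    have := mul_le_mul_of_nonneg_left ha (mul_nonneg (mul_self_nonneg cd) (mul_self_nonneg cφ))
    calc ((aφ : ℚ) : ℝ) = (cd * cd * (star d ⬝ᵥ d).re) * (cφ * cφ * (star φ ⬝ᵥ φ).re) * aφ := by
            rw [hcdd, hcφφ, one_mul, one_mul]
      _ = (cd * cd) * (cφ * cφ) * (((aφ : ℚ) : ℝ) * ((star d ⬝ᵥ d).re * (star φ ⬝ᵥ φ).re)) := by ring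
      _ ≤ (cd * cd) * (cφ * cφ) * ‖star d ⬝ᵥ φ‖ ^ 2 := this
  have hwy : ((w : ℚ) : ℝ) ≤ y ^ 2 := by
    rw [hys]
    have := mul_le_mul_of_nonneg_left (h.2 ψ hψ) (mul_nonneg (mul_self_nonneg cφ) (mul_self_nonneg cψ))
    calc ((w : ℚ) : ℝ) = (cφ * cφ * (star φ ⬝ᵥ φ).re) * (cψ * cψ * (star ψ ⬝ᵥ ψ).re) * w := by
            rw [hcφφ, hcψψ, one_mul, one_mul]
      _ = (cφ * cφ) * (cψ * cψ) * (((w : ℚ) : ℝ) * ((star φ ⬝ᵥ φ).re * (star ψ ⬝ᵥ ψ).re)) := by ring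
      _ ≤ (cφ * cφ) * (cψ * cψ) * ‖star φ ⬝ᵥ ψ‖ ^ 2 := this
  -- `x, y ≤ 1` (Cauchy–Schwarz for unit vectors)
  have hx1 : x ≤ 1 := by
    have h1 : x ^ 2 ≤ 1 := by
      have := norm_star_dotProduct_sq_le φ' d'
      rwa [hcφ1, hcd1, Complex.one_re, mul_one] at this
    nlinarith [norm_nonneg (star φ' ⬝ᵥ d')]
  have hy1 : y ≤ 1 := by
    have h1 : y ^ 2 ≤ 1 := by
      have := norm_star_dotProduct_sq_le φ' ψ'
      rwa [hcφ1, hcψ1, Complex.one_re, mul_one] at this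
    nlinarith [norm_nonneg (star φ' ⬝ᵥ ψ')]
  -- transfer: `√w' ≤ xy − √((1−x²)(1−y²)) ≤ z`
  have ht := norm_star_dotProduct_ge_of_unit hcd1 hcφ1 hcψ1
  have hD' : (0 : ℝ) ≤ ((aφ : ℚ) : ℝ) * w - w' - (1 - aφ) * (1 - w) := by exact_mod_cast hD
  have hD2' : (4 : ℝ) * w' * ((1 - ((aφ : ℚ) : ℝ)) * (1 - w)) ≤
      (((aφ : ℚ) : ℝ) * w - w' - (1 - aφ) * (1 - w)) ^ 2 := by exact_mod_cast hD2
  have hs := sqrt_le_of_transfer_test (a := ((aφ : ℚ) : ℝ)) (w := ((w : ℚ) : ℝ)) (w' := ((w' : ℚ) : ℝ))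
    (x := x) (y := y) (by exact_mod_cast ha0) (by exact_mod_cast hw0) (by exact_mod_cast hw'0)
    (norm_nonneg _) hx1 (norm_nonneg _) hy1 hax hwy hD' hD2'
  have hzw : ((w' : ℚ) : ℝ) ≤ z ^ 2 := by
    have h1 : Real.sqrt w' ≤ z := hs.trans ht
    have h2 : Real.sqrt ((w' : ℚ) : ℝ) ^ 2 ≤ z ^ 2 :=
      pow_le_pow_left₀ (Real.sqrt_nonneg _) h1 2
    rwa [Real.sq_sqrt (by exact_mod_cast hw'0)] at h2
  -- un-normalise
  rw [hzs] at hzw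
  have hn : 0 ≤ (star d ⬝ᵥ d).re * (star ψ ⬝ᵥ ψ).re :=
    mul_nonneg (re_star_dotProduct_self_nonneg d) (re_star_dotProduct_self_nonneg ψ)
  calc ((w' : ℚ) : ℝ) * ((star d ⬝ᵥ d).re * (star ψ ⬝ᵥ ψ).re)
      ≤ (cd * cd) * (cψ * cψ) * ‖star d ⬝ᵥ ψ‖ ^ 2 * ((star d ⬝ᵥ d).re * (star ψ ⬝ᵥ ψ).re) :=
        mul_le_mul_of_nonneg_right hzw hn
    _ = (cd * cd * (star d ⬝ᵥ d).re) * (cψ * cψ * (star ψ ⬝ᵥ ψ).re) * ‖star d ⬝ᵥ ψ‖ ^ 2 := by ring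
    _ = ‖star d ⬝ᵥ ψ‖ ^ 2 := by rw [hcdd, hcψψ, one_mul, one_mul]

/-! ## §3 Kernel entries: two exact-`ℚ` CI records; a single-determinant target -/

/-- The Fock vector of the one-determinant record `(D; 1)` is the basis vector `|D⟩`. [folklore] -/
theorem CIVec.vec_single (D : Finset (Orb (Fin k))) :
    (⟨fun _ => D, fun _ => 1⟩ : CIVec k 1).vec = Pi.single D 1 := by
  simp [CIVec.vec]

/-- The one-determinant record `(D; 1)` has `normSq = 1`. [folklore] -/
theorem CIVec.normSq_single (D : Finset (Orb (Fin k))) :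
    (⟨fun _ => D, fun _ => 1⟩ : CIVec k 1).normSq = 1 := by
  simp [CIVec.normSq]

/-- **KERNEL ENTRY: transfer between two exact-`ℚ` CI records.** From `OverlapLowerRow F a b φ.vec w` (record `φ`,
e.g. `CIVec.overlapLowerRow` of the sibling file) to `OverlapLowerRow F a b d.vec w′` (record `d`), given the
DECIDABLE facts `0 < d.normSq`, `0 < φ.normSq`, `aφ·(d.normSq·φ.normSq) ≤ (d.crossNormSq φ)²` (the exact cosine
of the two records, bridge `CIVec.star_vec_dotProduct_vec_vec`), `0 ≤ aφ`, `0 ≤ w`, `0 ≤ w′` and the transfer test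
`0 ≤ Δ ∧ 4w′(1 − aφ)(1 − w) ≤ Δ²`. [cite: Goodisman1973, Ch. III §A.2 eqs. (10)–(12), pp. 92–93] -/
theorem CIVec.overlapLowerRow_transfer {n m : ℕ} (φ : CIVec k n) (d : CIVec k m) {w aφ w' : ℚ}
    (h : OverlapLowerRow F a b φ.vec w) (hφ : 0 < φ.normSq) (hd : 0 < d.normSq)
    (ha : aφ * (d.normSq * φ.normSq) ≤ (d.crossNormSq φ) ^ 2) (ha0 : 0 ≤ aφ) (hw0 : 0 ≤ w) (hw'0 : 0 ≤ w')
    (hD : 0 ≤ aφ * w - w' - (1 - aφ) * (1 - w))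
    (hD2 : 4 * w' * ((1 - aφ) * (1 - w)) ≤ (aφ * w - w' - (1 - aφ) * (1 - w)) ^ 2) :
    OverlapLowerRow F a b d.vec w' := by
  refine h.transfer (CIVec.vec_ne_zero_of_normSq_pos hφ) (CIVec.vec_ne_zero_of_normSq_pos hd)
    ?_ ha0 hw0 hw'0 hD hD2
  rw [CIVec.star_vec_dotProduct_vec, CIVec.star_vec_dotProduct_vec, CIVec.star_vec_dotProduct_vec_vec,
    Complex.ratCast_re, Complex.ratCast_re, Complex.norm_ratCast, sq_abs]
  exact_mod_cast ha

/-- **KERNEL ENTRY: the REFERENCE-DETERMINANT WEIGHT through a correlated record.** From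
`OverlapLowerRow F a b φ.vec w` (Eckart row of a CI record `φ` that lies below the gap leg) to the weight row of a
determinant `D`: with `aφ·φ.normSq ≤ c_D²`, `c_D = Σ_{i : D_i = D} c_i` the record's exact coefficient at `D`
(`= (D;1).crossNormSq φ`), and the transfer test, `OverlapLowerRow F a b (Pi.single D 1) w′` — i.e. every ground
state `ψ` of `F` in `(a, b)` has `|ψ(D)|² ≥ w′·‖ψ‖²` (`OverlapLowerRow.weight_le`). This is the certified counterpart
of the leading-determinant weight `w₀` for a file whose bare determinant energy lies ABOVE the certified gap leg.
[cite: Goodisman1973, Ch. III §A.2 eqs. (10)–(12), pp. 92–93] -/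
theorem CIVec.weightRow_transfer {n : ℕ} (φ : CIVec k n) (D : Finset (Orb (Fin k))) {w aφ w' : ℚ}
    (h : OverlapLowerRow F a b φ.vec w) (hφ : 0 < φ.normSq)
    (ha : aφ * φ.normSq ≤ ((⟨fun _ => D, fun _ => 1⟩ : CIVec k 1).crossNormSq φ) ^ 2)
    (ha0 : 0 ≤ aφ) (hw0 : 0 ≤ w) (hw'0 : 0 ≤ w')
    (hD : 0 ≤ aφ * w - w' - (1 - aφ) * (1 - w))
    (hD2 : 4 * w' * ((1 - aφ) * (1 - w)) ≤ (aφ * w - w' - (1 - aφ) * (1 - w)) ^ 2) :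
    OverlapLowerRow F a b (Pi.single D 1) w' := by
  rw [← CIVec.vec_single D]
  refine CIVec.overlapLowerRow_transfer φ ⟨fun _ => D, fun _ => 1⟩ h hφ
    (by rw [CIVec.normSq_single]; exact one_pos) ?_ ha0 hw0 hw'0 hD hD2
  rw [CIVec.normSq_single, one_mul]
  exact ha

/-! ## §4 Reading an overlap row as a WEIGHT ON A DETERMINANT SET (appended 2026-08-27, chem-lead A21 (3)
«weight ≥ w′ on a named CSF/determinant set») -/

/-- Truncation of a Fock vector to a determinant set `T` (the orthogonal projection onto `span T`, written
pointwise; local helper). [folklore] -/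
private theorem star_dotProduct_truncate_eq {φ ψ : Fock (Orb (Fin k))} {T : Finset (Finset (Orb (Fin k)))}
    (hT : ∀ s, s ∉ T → φ s = 0) :
    star φ ⬝ᵥ (fun s => if s ∈ T then ψ s else 0) = star φ ⬝ᵥ ψ := by
  simp only [dotProduct, Pi.star_apply]
  refine Finset.sum_congr rfl fun s _ => ?_
  by_cases hs : s ∈ T
  · rw [if_pos hs]
  · rw [if_neg hs, hT s hs, star_zero, zero_mul, zero_mul]

/-- The norm square of the truncation to `T` is the WEIGHT of `T`: `Σ_{s ∈ T} |ψ(s)|²`. [folklore] -/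
private theorem re_star_dotProduct_truncate_self (ψ : Fock (Orb (Fin k))) (T : Finset (Finset (Orb (Fin k)))) :
    (star (fun s => if s ∈ T then ψ s else 0) ⬝ᵥ (fun s => if s ∈ T then ψ s else 0)).re =
      ∑ s ∈ T, ‖ψ s‖ ^ 2 := by
  rw [re_star_dotProduct_self, ← Finset.sum_filter_add_sum_filter_not Finset.univ (· ∈ T)]
  have h1 : ∑ s ∈ Finset.univ.filter (· ∈ T), ‖(if s ∈ T then ψ s else 0)‖ ^ 2 = ∑ s ∈ T, ‖ψ s‖ ^ 2 := by
    rw [show Finset.univ.filter (· ∈ T) = T from by ext s; simp]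
    exact Finset.sum_congr rfl fun s hs => by rw [if_pos hs]
  have h2 : ∑ s ∈ Finset.univ.filter (fun s => ¬ s ∈ T), ‖(if s ∈ T then ψ s else 0)‖ ^ 2 = 0 :=
    Finset.sum_eq_zero fun s hs => by rw [if_neg (Finset.mem_filter.1 hs).2, norm_zero, zero_pow two_ne_zero]
  rw [h1, h2, add_zero]

/-- **WEIGHT ON A DETERMINANT SET from an overlap row.** If every ground state `ψ` of `F` in `(a, b)` has
`cos² ∠(φ, ψ) ≥ w` (`OverlapLowerRow F a b φ w`) for an explicit NONZERO `φ` SUPPORTED IN the determinant set `T`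
(a configuration state function on a reference occupation pattern, say), then every ground state carries weight
`Σ_{s ∈ T} |ψ(s)|² ≥ w·‖ψ‖²` on `T` (`|⟨φ, ψ⟩|² = |⟨φ, P_T ψ⟩|² ≤ ‖φ‖²·‖P_T ψ‖²`, Cauchy–Schwarz). The «weight
on a named CSF/determinant set» reading of the REFCHAR token for open-shell references (chem-lead A21 (3)).
[cite: Goodisman1973, Ch. III §A.2 eqs. (10)–(12), pp. 92–93] -/
theorem OverlapLowerRow.setWeight_le {φ : Fock (Orb (Fin k))} {w : ℚ} (h : OverlapLowerRow F a b φ w)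
    (hφ0 : φ ≠ 0) {T : Finset (Finset (Orb (Fin k)))} (hT : ∀ s, s ∉ T → φ s = 0)
    {ψ : Fock (Orb (Fin k))} (hψ : F.IsGroundState a b ψ) :
    ((w : ℚ) : ℝ) * (star ψ ⬝ᵥ ψ).re ≤ ∑ s ∈ T, ‖ψ s‖ ^ 2 := by
  set ψT : Fock (Orb (Fin k)) := fun s => if s ∈ T then ψ s else 0 with hψT
  have h1 := h.2 ψ hψ
  rw [← star_dotProduct_truncate_eq (ψ := ψ) hT] at h1
  have hCS := norm_star_dotProduct_sq_le φ ψT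
  rw [re_star_dotProduct_truncate_self ψ T] at hCS
  have hφpos : 0 < (star φ ⬝ᵥ φ).re := re_star_dotProduct_self_pos hφ0
  have h2 : ((w : ℚ) : ℝ) * (star ψ ⬝ᵥ ψ).re * (star φ ⬝ᵥ φ).re ≤
      (∑ s ∈ T, ‖ψ s‖ ^ 2) * (star φ ⬝ᵥ φ).re := by
    calc ((w : ℚ) : ℝ) * (star ψ ⬝ᵥ ψ).re * (star φ ⬝ᵥ φ).re
        = ((w : ℚ) : ℝ) * ((star φ ⬝ᵥ φ).re * (star ψ ⬝ᵥ ψ).re) := by ring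
      _ ≤ ‖star φ ⬝ᵥ ψT‖ ^ 2 := h1
      _ ≤ (star φ ⬝ᵥ φ).re * ∑ s ∈ T, ‖ψ s‖ ^ 2 := hCS
      _ = (∑ s ∈ T, ‖ψ s‖ ^ 2) * (star φ ⬝ᵥ φ).re := by ring
  exact le_of_mul_le_mul_right h2 hφpos

/-- **KERNEL ENTRY: set weight from a CI-record overlap row.** For an exact-`ℚ` CI record `v` with all its
determinants in `T` and `0 < v.normSq`: `OverlapLowerRow F a b v.vec w` ⇒ every ground state `ψ` of `F` in
`(a, b)` has `Σ_{s ∈ T} |ψ(s)|² ≥ w·‖ψ‖²` (e.g. `T` = the covalent determinants of an open-shell reference pattern,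
`v` = the singlet CSF on it with its rational coefficients up to a common factor).
[cite: Goodisman1973, Ch. III §A.2 eqs. (10)–(12), pp. 92–93] -/
theorem CIVec.setWeight_le {n : ℕ} (v : CIVec k n) {w : ℚ} (h : OverlapLowerRow F a b v.vec w)
    (hpos : 0 < v.normSq) {T : Finset (Finset (Orb (Fin k)))} (hT : ∀ i, v.det i ∈ T)
    {ψ : Fock (Orb (Fin k))} (hψ : F.IsGroundState a b ψ) :
    ((w : ℚ) : ℝ) * (star ψ ⬝ᵥ ψ).re ≤ ∑ s ∈ T, ‖ψ s‖ ^ 2 := by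
  refine h.setWeight_le (CIVec.vec_ne_zero_of_normSq_pos hpos) (fun s hs => ?_) hψ
  simp only [CIVec.vec, Finset.sum_apply, Pi.smul_apply, smul_eq_mul]
  refine Finset.sum_eq_zero fun i _ => ?_
  rw [Pi.single_apply, if_neg, mul_zero]
  rintro rfl
  exact hs (hT i)

end Summit.Ventures.CertifiedQuantumChemistry

end
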